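import Summits.HubbardSuperconductivity.HubbardSuperconductivity.Theorems.AnisotropyChordTransferFibre3ShellIngredients

/-!
# Route `AnisotropyChord` / H0 rotor rung: PartN39 — pointwise bounds on the summand of the shell majorant

Preparation for the proof of `RateLemma.ShellMajorant` (PORT PartN39, memo 21 §321(a)): with `θ = 2π/L`, integer target
`r = (x,y)` and `m = (valMinAbs k₁, valMinAbs k₂)` the symmetric representatives of `k`,
* `kdotC_sq_le` — the centred product angle obeys `(k·r)_c² ≤ θ²(m₁x + m₂y)²` (minimality of `valMinAbs`);
* `summand_le` — for `0 < c ≤ 2ε(2ε − λ)`: `min 2 ((k·r)_c²/2)/((2ε)²(1 − λ/2ε)) ≤ θ²(m·r)²/(2c)`;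
* the three shell regimes (`λ ≤ (3/2)ε₁`): `S₁` (`ε = ε₁`, `c = ε₁²`), `S₂` (`ε = 2ε₁`, `c = 10ε₁²`), far
  (`ε ≥ 3.414ε₁` and Jordan `ε ≥ (2/π²)θ²|m|²`, `c = 2a((2/π²)θ²|m|²)²`, `a = 2 − 1.5/3.414`), read on representatives;
* classification of the first two shells by `(|m₁|, |m₂|)`.
Prover seat `hubbard-h0-rotor-p2` g0; helper for stmt-HubbardSuperconductivity-19089 (`--supports`, helper class).
WHAT THIS IS NOT: nothing here proves superconductivity in the Hubbard model; helper lemmas of ONE conditional reduction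
(rung 19089, HOLE₂(.75) near-pair tail, RATE lemma).  Mathlib + tree imports only; no sorry, no axioms.
-/

set_option linter.dupNamespace false

noncomputable section

namespace Summit.HubbardSuperconductivity.HubbardSuperconductivity.Theorems.AnisotropyChord.Transfer.Fibre3

namespace RateLemma

open Real

variable (L : ℕ) [NeZero L]

/-- the centred product angle is at most `θ·|m₁x + m₂y|` in square: `(k·r)_c² ≤ θ²(m·r)²`. -/
theorem kdotC_sq_le (k : Tor L) (x y : ℤ) :
    (kdotC L k (((x : ZMod L)), ((y : ZMod L)))) ^ 2
      ≤ (2 * Real.pi / L) ^ 2 * (((k.1.valMinAbs * x + k.2.valMinAbs * y : ℤ)) : ℝ) ^ 2 := by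
  unfold kdotC
  set z : ℤ := k.1.valMinAbs * x + k.2.valMinAbs * y with hz
  set v : ℤ := ((k.1 * (x : ZMod L) + k.2 * (y : ZMod L) : ZMod L)).valMinAbs with hv
  have he : ((v : ℤ) : ZMod L) = ((z : ℤ) : ZMod L) := by
    rw [hv, ZMod.coe_valMinAbs, hz]
    push_cast
    rfl
  have hle : v.natAbs ≤ z.natAbs :=
    ZMod.natAbs_min_of_le_div_two L v z he (ZMod.natAbs_valMinAbs_le _)
  have habs : |(v : ℝ)| ≤ |(z : ℝ)| := by
    rw [← Int.cast_abs, ← Int.cast_abs, Int.abs_eq_natAbs, Int.abs_eq_natAbs]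
    exact_mod_cast hle
  have hsq : (v : ℝ) ^ 2 ≤ (z : ℝ) ^ 2 := sq_le_sq.2 habs
  have hL : (0 : ℝ) < L := by exact_mod_cast Nat.pos_of_ne_zero (NeZero.ne L)
  have e : (2 * Real.pi * (v : ℝ) / L) ^ 2 = (2 * Real.pi / L) ^ 2 * (v : ℝ) ^ 2 := by ring
  rw [show (2 * Real.pi * ((((k.1 * (x : ZMod L) + k.2 * (y : ZMod L) : ZMod L)).valMinAbs : ℤ) : ℝ) / L)
      = 2 * Real.pi * (v : ℝ) / L by rw [hv], e]
  exact mul_le_mul_of_nonneg_left hsq (by positivity)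

omit [NeZero L] in
/-- the generic summand bound: if `0 < c ≤ 2ε(2ε − λ)` and `(k·r)_c² ≤ θ²M²` then
`min 2 ((k·r)_c²/2) / ((2ε)²(1 − λ/(2ε))) ≤ θ²M²/(2c)`. -/
theorem summand_le (ε lam kd θ M c : ℝ) (hε : ε ≠ 0) (hc : 0 < c) (hcle : c ≤ 2 * ε * (2 * ε - lam))
    (hkd : kd ^ 2 ≤ θ ^ 2 * M ^ 2) :
    min 2 (kd ^ 2 / 2) / ((2 * ε) ^ 2 * (1 - lam / (2 * ε))) ≤ θ ^ 2 * M ^ 2 / (2 * c) := by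
  have hden : (2 * ε) ^ 2 * (1 - lam / (2 * ε)) = 2 * ε * (2 * ε - lam) := by
    field_simp
  rw [hden]
  have hpos : 0 < 2 * ε * (2 * ε - lam) := lt_of_lt_of_le hc hcle
  have h1 : min 2 (kd ^ 2 / 2) ≤ θ ^ 2 * M ^ 2 / 2 := le_trans (min_le_right _ _) (by linarith)
  have h0 : 0 ≤ θ ^ 2 * M ^ 2 / 2 := by positivity
  calc min 2 (kd ^ 2 / 2) / (2 * ε * (2 * ε - lam))
      ≤ (θ ^ 2 * M ^ 2 / 2) / (2 * ε * (2 * ε - lam)) := div_le_div_of_nonneg_right h1 hpos.le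
    _ ≤ (θ ^ 2 * M ^ 2 / 2) / c := div_le_div_of_nonneg_left h0 hc hcle
    _ = θ ^ 2 * M ^ 2 / (2 * c) := by rw [div_div]

/-! ## Reading the first two shells on representatives -/

omit [NeZero L] in
/-- `wInt m = ε₁` when `|m| = 1`. -/
theorem wInt_of_natAbs_one {m : ℤ} (h : m.natAbs = 1) : wInt L m = eps1 L := by
  rw [← wInt_natAbs, h]; exact_mod_cast wInt_one L

omit [NeZero L] in
/-- `wInt m = 0` when `|m| = 0`. -/
theorem wInt_of_natAbs_zero {m : ℤ} (h : m.natAbs = 0) : wInt L m = 0 := by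
  rw [Int.natAbs_eq_zero.1 h]; exact wInt_zero L

/-- on `S₁` (`|m₁| + |m₂| = 1`): `ε(k) = ε₁`. -/
theorem epsT_shellOne (k : Tor L) (h : k.1.valMinAbs.natAbs + k.2.valMinAbs.natAbs = 1) :
    epsT L k = eps1 L := by
  rw [epsT_eq_wInt]
  rcases Nat.eq_zero_or_pos k.1.valMinAbs.natAbs with h1 | h1
  · have h2 : k.2.valMinAbs.natAbs = 1 := by omega
    rw [wInt_of_natAbs_zero L h1, wInt_of_natAbs_one L h2]; ring
  · have h1' : k.1.valMinAbs.natAbs = 1 := by omega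
    have h2 : k.2.valMinAbs.natAbs = 0 := by omega
    rw [wInt_of_natAbs_one L h1', wInt_of_natAbs_zero L h2]; ring

/-- on `S₂` (`|m₁| = |m₂| = 1`): `ε(k) = 2ε₁`. -/
theorem epsT_shellTwo (k : Tor L) (h : k.1.valMinAbs.natAbs = 1 ∧ k.2.valMinAbs.natAbs = 1) :
    epsT L k = 2 * eps1 L := by
  rw [epsT_eq_wInt, wInt_of_natAbs_one L h.1, wInt_of_natAbs_one L h.2]; ring

omit [NeZero L] in
/-- the typed `firstShells` are exactly the `k` whose representatives lie on `S₁ ∪ S₂` (direction used: `∈ ⇒`). -/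
theorem natAbs_of_mem_firstShells (hL : 2 ≤ L) (k : Tor L) (hk : k ∈ firstShells L) :
    k.1.valMinAbs.natAbs + k.2.valMinAbs.natAbs = 1 ∨
      (k.1.valMinAbs.natAbs = 1 ∧ k.2.valMinAbs.natAbs = 1) := by
  have h1 : ((1 : ZMod L)).valMinAbs.natAbs = 1 := by rw [valMinAbs_one L hL]; rfl
  have hm1 : ((-1 : ZMod L)).valMinAbs.natAbs = 1 := by rw [ZMod.natAbs_valMinAbs_neg, h1]
  simp only [firstShells, Finset.mem_insert, Finset.mem_singleton] at hk
  rcases hk with rfl | rfl | rfl | rfl | rfl | rfl | rfl | rfl <;> simp [h1, hm1]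

/-! ## The three regimes of the denominator `2ε(2ε − λ)` for `λ ≤ (3/2)ε₁` -/

omit [NeZero L] in
/-- `S₁`: `ε = ε₁` ⇒ `ε₁² ≤ 2ε(2ε − λ)`. -/
theorem den_shellOne (ε₁ lam : ℝ) (hlam : lam ≤ 3 / 2 * ε₁) (h0 : 0 ≤ ε₁) :
    ε₁ ^ 2 ≤ 2 * ε₁ * (2 * ε₁ - lam) := by nlinarith

omit [NeZero L] in
/-- `S₂`: `ε = 2ε₁` ⇒ `10ε₁² ≤ 2ε(2ε − λ)`. -/
theorem den_shellTwo (ε₁ lam : ℝ) (hlam : lam ≤ 3 / 2 * ε₁) (h0 : 0 ≤ ε₁) :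
    10 * ε₁ ^ 2 ≤ 2 * (2 * ε₁) * (2 * (2 * ε₁) - lam) := by nlinarith

omit [NeZero L] in
/-- far: `ε ≥ 3.414ε₁`, `ε ≥ J ≥ 0` ⇒ `2(2 − 1.5/3.414)J² ≤ 2ε(2ε − λ)`. -/
theorem den_far (ε ε₁ lam J : ℝ) (hlam : lam ≤ 3 / 2 * ε₁) (h0 : 0 ≤ ε₁) (hfar : 3.414 * ε₁ ≤ ε)
    (hJ0 : 0 ≤ J) (hJ : J ≤ ε) :
    2 * (2 - 1.5 / 3.414) * J ^ 2 ≤ 2 * ε * (2 * ε - lam) := by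
  have hε0 : 0 ≤ ε := le_trans hJ0 hJ
  have h1 : 2 * ε - lam ≥ (2 - 1.5 / 3.414) * ε := by
    have : lam ≤ 1.5 / 3.414 * ε := by
      have : 3 / 2 * ε₁ ≤ 1.5 / 3.414 * ε := by
        rw [show (1.5 : ℝ) / 3.414 * ε = 3 / 2 * (ε / 3.414) by ring]
        apply mul_le_mul_of_nonneg_left _ (by norm_num)
        rw [le_div_iff₀ (by norm_num : (0:ℝ) < 3.414)]; linarith
      linarith
    nlinarith
  have h2 : J ^ 2 ≤ ε ^ 2 := pow_le_pow_left₀ hJ0 hJ 2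
  have ha : (0 : ℝ) ≤ 2 - 1.5 / 3.414 := by norm_num
  calc 2 * (2 - 1.5 / 3.414) * J ^ 2 ≤ 2 * (2 - 1.5 / 3.414) * ε ^ 2 := by nlinarith
    _ = 2 * ε * ((2 - 1.5 / 3.414) * ε) := by ring
    _ ≤ 2 * ε * (2 * ε - lam) := by nlinarith

end RateLemma

end Summit.HubbardSuperconductivity.HubbardSuperconductivity.Theorems.AnisotropyChord.Transfer.Fibre3

end
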